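import Mathlib
import HarnessLib
import Literature.MathematicalPhysics.QuantumLattice.FermiRG.FKTFermiLiquidOverview
import Literature.MathematicalPhysics.QuantumLattice.HubbardUmklappKinematics
import Literature.MathematicalPhysics.QuantumLattice.KohnLuttinger

/-!
# Route `KLProgramme` (crux K3, risk r2): the Fermi-curve hypothesis set of Feldman–Knörrer–Trubowitz 2004
# («A two dimensional Fermi liquid», overview), AS TYPED in `FermiRG/FKTFermiLiquidOverview.lean`, is NOT
# satisfiable by the square-lattice band — a typing remark completing the census of typed hypothesis sets

Cell `gate-hubbard-kl`, seat fs-1 (companion of `KLProgrammeFermiSurfaceFKTRemark.lean`, which records the same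
for the ladder paper's `FKTLadders.DispersionHyp`). The typer file `FKTFermiLiquidOverview.lean` (t7) packages
FKT's hypothesis (hypNPdisprel) as `FKT2004.FermiCurveData.IsRegular r D` / `FKT2004.Hypotheses r D` over
Fermi-curve DATA `D = (e, γ, φ, ρ)` with `e : ℝ² → ℝ` a CONTINUUM dispersion: `γ` is a continuous
`2π`-periodic Gauss-map parametrisation with `range γ = F = {e = 0} ⊂ ℝ²` — so `F` must be COMPACT — and
`Hypotheses` adds STRONG ASYMMETRY (`StronglyAsymmetric`), which by FKT's own Remark ii) excludes every curve
symmetric under `k ↦ -k`. For any data whose dispersion is the lattice band `e = ε - μ`,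
`ε(k) = -2 (cos k₀ + cos k₁)`, `-4 ≤ μ ≤ 0`: the `ℝ²`-level set contains the translated antinodes
`(K(μ) + 2πn, 0)` and is unbounded (`klfs_fkt2004_fermiCurve_not_isBounded`), hence not compact, hence
`¬ D.IsRegular r` (`klfs_fkt2004_not_isRegular`) and `¬ FKT2004.Hypotheses r D` (`klfs_fkt2004_not_hypotheses`)
for every `r` and every choice of `(γ, φ, ρ)`. What IS true for the Hubbard band is the torus version of the
regularity clauses (strict convexity, curvature bounded below, `∇e ≠ 0`: `KLProgrammeFermiSurfaceEnvelope/FST2*`)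
— but NOT strong asymmetry: the programme consumes FKT 2004 only through its symmetric-case content
(particle–hole ladders, sectors), never through the asymmetric Fermi-liquid theorem. No definitions; everything
PROVED. [folklore]
-/

noncomputable section

open Real Set

-- the tree's namespace `Summit.<Summit>.<Problem>.Theorems` repeats the summit name by design (D-0017)
set_option linter.dupNamespace false

namespace Summit.HubbardSuperconductivity.HubbardSuperconductivity.Theorems

open Literature.MathematicalPhysics.QuantumLattice

/-- The translated antinodes `(K(μ) + 2πn, 0)` lie on the `ℝ²`-Fermi curve `{ε - μ = 0}` of FKT 2004's
typing (`-4 ≤ μ ≤ 0`). [folklore] -/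
theorem klfs_fkt2004_antinode_translate_mem {μ : ℝ} (hμ₁ : -4 ≤ μ) (hμ₂ : μ ≤ 0) (n : ℕ) :
    (WithLp.toLp 2 ![umklappRadius μ + n * (2 * π), 0] : Momentum) ∈
      FermiRG.FKT2004.fermiCurve (fun k : Momentum => squareDispersion 1 0 k - μ) := by
  have hc : Real.cos (umklappRadius μ) = -μ / 2 - 1 := by
    rw [umklappRadius, Real.cos_arccos (by linarith) (by linarith)]
  show squareDispersion 1 0 (WithLp.toLp 2 ![umklappRadius μ + n * (2 * π), 0]) - μ = 0
  simp [squareDispersion, Real.cos_add_nat_mul_two_pi, hc]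
  ring

/-- **The `ℝ²`-Fermi curve of the lattice band is unbounded** (`-4 ≤ μ ≤ 0`). [folklore] -/
theorem klfs_fkt2004_fermiCurve_not_isBounded {μ : ℝ} (hμ₁ : -4 ≤ μ) (hμ₂ : μ ≤ 0) :
    ¬ Bornology.IsBounded (FermiRG.FKT2004.fermiCurve (fun k : Momentum => squareDispersion 1 0 k - μ)) := by
  intro hb
  obtain ⟨C, hC⟩ := hb.exists_norm_le
  obtain ⟨n, hn⟩ := exists_nat_gt C
  have hle := hC _ (klfs_fkt2004_antinode_translate_mem hμ₁ hμ₂ n)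
  have hK := umklappRadius_nonneg μ
  have hcoord := PiLp.norm_apply_le (WithLp.toLp 2 ![umklappRadius μ + n * (2 * π), 0] : Momentum) 0
  have h0 : ‖(WithLp.toLp 2 ![umklappRadius μ + n * (2 * π), 0] : Momentum) 0‖ = umklappRadius μ + n * (2 * π) := by
    simp only [Matrix.cons_val_zero, Real.norm_eq_abs]
    exact abs_of_nonneg (by positivity)
  have hπ : (3 : ℝ) < π := Real.pi_gt_three
  have hn0 : (0 : ℝ) ≤ n := n.cast_nonneg
  nlinarith

/-- **… hence not compact**: FKT 2004's standing compactness of `F` (footnote (1): the UV cutoff is `1` on a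
neighbourhood of `F`, «so `F` is compact»), as typed over the continuum, fails for the lattice band. [folklore] -/
theorem klfs_fkt2004_fermiCurve_not_isCompact {μ : ℝ} (hμ₁ : -4 ≤ μ) (hμ₂ : μ ≤ 0) :
    ¬ IsCompact (FermiRG.FKT2004.fermiCurve (fun k : Momentum => squareDispersion 1 0 k - μ)) :=
  fun h => klfs_fkt2004_fermiCurve_not_isBounded hμ₁ hμ₂ h.isBounded

/-- **No Fermi-curve data over the lattice band is regular in FKT 2004's typed sense**: `IsRegular` asks for
a continuous `2π`-periodic `γ` with `range γ = F`, which would make `F` compact. [folklore] -/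
theorem klfs_fkt2004_not_isRegular {μ : ℝ} (hμ₁ : -4 ≤ μ) (hμ₂ : μ ≤ 0) (D : FermiRG.FKT2004.FermiCurveData)
    (hD : D.e = fun k : Momentum => squareDispersion 1 0 k - μ) (r : ℕ) : ¬ D.IsRegular r := by
  intro h
  have hcpt : IsCompact (Set.range D.γ) :=
    h.periodic.compact_of_continuous Real.two_pi_pos.ne' h.continuous_γ
  rw [h.range_eq, hD] at hcpt
  exact klfs_fkt2004_fermiCurve_not_isCompact hμ₁ hμ₂ hcpt

/-- **`¬ FKT2004.Hypotheses r D`** for every `r` and every Fermi-curve data over the lattice band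
(`-4 ≤ μ ≤ 0`, in particular on both programme windows): the typed hypothesis set of FKT's asymmetric
Fermi-liquid theorem cannot be instantiated at a periodic dispersion (and, on the torus, strong asymmetry
would still fail for the symmetric Hubbard curve, FKT Remark ii)). [folklore] -/
theorem klfs_fkt2004_not_hypotheses {μ : ℝ} (hμ₁ : -4 ≤ μ) (hμ₂ : μ ≤ 0) (D : FermiRG.FKT2004.FermiCurveData)
    (hD : D.e = fun k : Momentum => squareDispersion 1 0 k - μ) (r : ℕ) : ¬ FermiRG.FKT2004.Hypotheses r D :=
  fun h => klfs_fkt2004_not_isRegular hμ₁ hμ₂ D hD r h.regular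

/-- Window form: on `μ ∈ [-0.4267, -0.1798]` and on `[-1, -0.15]` no data over the Hubbard band satisfies
`FKT2004.Hypotheses`. [folklore] -/
theorem klfs_windows_fkt2004_not_hypotheses {μ : ℝ}
    (hμ : μ ∈ Icc (-0.4267 : ℝ) (-0.1798) ∨ μ ∈ Icc (-1 : ℝ) (-0.15)) (D : FermiRG.FKT2004.FermiCurveData)
    (hD : D.e = fun k : Momentum => squareDispersion 1 0 k - μ) (r : ℕ) : ¬ FermiRG.FKT2004.Hypotheses r D := by
  rcases hμ with ⟨h1, h2⟩ | ⟨h1, h2⟩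
  · exact klfs_fkt2004_not_hypotheses (by linarith) (by linarith) D hD r
  · exact klfs_fkt2004_not_hypotheses (by linarith) (by linarith) D hD r

end Summit.HubbardSuperconductivity.HubbardSuperconductivity.Theorems

end
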